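import Literature.AlgebraicGeometry.HodgeTheory.AnalytificationCartierDivisor
import Literature.Geometry.Kaehler.GrauertOkaPrinciple
import Literature.AlgebraicGeometry.FundamentalGroup.RiemannExistenceContinuousRational
import Literature.AlgebraicGeometry.Motives.AbelianVarietyDegree
import HarnessLib

/-!
# GAGA on `Pic`, the carrier-free half: Cartier divisors whose cocycles are continuously isomorphic
# BY AN ISOMORPHISM MATCHING TWO NONZERO ALGEBRAIC SECTIONS are linearly equivalent

Topic `AlgebraicGeometry/HodgeTheory`; namespace `Literature.AlgebraicGeometry.HodgeTheory`.  Cell hodgecm-mathlib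
(D-0151), rung-0 memo `B-plan/M1PRIME-DAG.md` §9 blocker row **B1 «GAGA injectivity on Pic»** (road (b4) of record,
D-pen verdict 2026-08-28T23:38Z): B1 = (C1) H⁰-GAGA for line bundles over the carrier `ℙ(L ⊕ 𝒪)` + THIS FILE («B1-fin»).
THEOREMS ONLY: no definition, no named fact, no instance, no `sorry` (net Literature debt 0).  HC_CM is proved only modulo
the printed citations until rung 0 closes.

## What is proved

Let `X` be an integral `ℂ`-scheme locally of finite type with REGULAR local rings (e.g. smooth), `φ : M → X(ℂ)` an
analytification (Serre, GAGA §2), and `G = (U_i, g_i)`, `G' = (U'_a, g'_a)` two Cartier divisors with NONZERO global sections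
`s ∈ Γ(X, 𝒪_X(G))`, `τ ∈ Γ(X, 𝒪_X(G'))` (`CartierDivisor.IsSection`: `g_i s` regular on `U_i`).  Suppose the holomorphic line
cocycles `𝒪_X(G)^an`, `𝒪_X(G')^an` (`cartierDivisorCocycle hφ G`, `… G'`) are isomorphic through a CONTINUOUS cocycle
isomorphism `Φ = (λ_{a i})` (`SmoothComplexVectorBundle.CocycleIso`, [FritzscheGrauert2002] Ch. IV §2) which carries the
analytification of `s` to that of `τ`: `λ_{a i}(m) · (g_i s)(φ m) = (g'_a τ)(φ m)` on `φ⁻¹((U_i ∩ U'_a)(ℂ))`.  Then `G` and `G'` are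
LINEARLY EQUIVALENT (`CartierDivisor.LinEquiv`): indeed the effective divisors `G + div s` and `G' + div τ` are the SAME divisor.

Proof ([SerreGAGA1956] n° 19–20 in spirit; the one analytic input is algebraic Hartogs for CONTINUOUS rational functions,
★ `ContinuousRational.isRegularAt_of_continuous`, [GortzWedhorn2020] Prop. B.73 (3) with Auslander–Buchsbaum
[Matsumura1987] Thm. 20.3; normal variant ★ `ContinuousRationalNormal.isRegularAt_of_continuous_of_normal`): on an affine open `V ∋ x` inside `U_i ∩ U'_a` the rational function `r = (g_i s)/(g'_a τ)` satisfies
`r(P) = λ_{a i}(φ⁻¹P)⁻¹` for `P ∈ V(ℂ)` — a CONTINUOUS nowhere-vanishing function — so `r` and `r⁻¹` are regular at `x`, hence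
`r ∈ 𝒪_{X,x}^×`; this is `(G + div s).SameDivisor (G' + div τ)`, and `G ~ G + div s`, `G' ~ G' + div τ`.

* `isRegularAt_div_of_continuousOn_eval` — the local Hartogs step for two rational functions regular on an open `W`,
  matched on `W(ℂ)` by a continuous `g`.
* `isUnitAt_div_of_continuousOn_eval` — the same with `g` continuous and nowhere zero: `b/a` is a UNIT at every point of `W`.
* **`CartierDivisor.sameDivisor_add_principal_of_cocycleIso`** — `(G + div s).SameDivisor (G' + div τ)`.
* **`CartierDivisor.linEquiv_of_cocycleIso_sectionCoord`** — `G.LinEquiv G'` (the head; B1-fin).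

NOT here: H⁰-GAGA (that every holomorphic section of `𝒪_X(G)^an` IS an `s^an` — road (b4), needs the carrier `ℙ(L ⊕ 𝒪)`);
the discharge of the regularity hypothesis `hreg` for smooth `X` (regularity of the stalks of a smooth variety; consumer-side).

## References
* [SerreGAGA1956] J.-P. Serre, *Géométrie algébrique et géométrie analytique*, Ann. Inst. Fourier 6 (1956), n° 19–20 pp. 29–32.
* [Matsumura1987] H. Matsumura, *Commutative Ring Theory* (1987), Thm. 11.5 p. 82.
* [GortzWedhorn2020] U. Görtz, T. Wedhorn, *Algebraic Geometry I*, 2nd ed. (2020), Thm. 6.45 p. 203; (11.9) Def. 11.20, p. 373–374.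
* [FritzscheGrauert2002] K. Fritzsche, H. Grauert, *From Holomorphic Functions to Complex Manifolds* (2002), Ch. IV §2.
-/

set_option autoImplicit false

noncomputable section

open scoped Manifold ContDiff Topology
open CategoryTheory AlgebraicGeometry TopologicalSpace Opposite
open Literature.AlgebraicGeometry.Motives
open Literature.AlgebraicGeometry.Motives.RatFn
open Literature.AlgebraicGeometry.Motives.AlgPoints
open Literature.NumberTheory.Transcendental
open Literature.Geometry.Kaehler
open Literature.AlgebraicGeometry.FundamentalGroup

namespace Literature.AlgebraicGeometry.HodgeTheory

universe u

/-! ### §1. The local Hartogs step for two matched rational functions -/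

section Local

variable {X : SchemeOver ℂ} [LocallyOfFiniteType X.hom] [IsIntegral X.left]

/-- **Local Hartogs step.**  `X` integral, locally of finite type over `ℂ`, with regular local rings; `a', b' ∈ K(X)`
regular on an open `W`, `a' ≠ 0`; `g` continuous on `W(ℂ)` with `g(P) · a'(P) = b'(P)` for `P ∈ W(ℂ)` (values through any
sections representing `a'`, `b'` on `W`).  Then `b'/a'` is regular at every point of `W` (affine-locally this is ★
`ContinuousRational.isRegularAt_of_continuous`). [cite: Matsumura1987, Thm. 11.5 (p. 82)]
[cite: GortzWedhorn2020, Thm. 6.45 (p. 203)] [cite: SerreGAGA1956, n° 19 (p. 29)] -/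
theorem isRegularAt_div_of_continuousOn_eval
    (hreg : ∀ x : X.left, IsRegularLocalRing (X.left.presheaf.stalk x))
    {W : X.left.Opens} (hW : genericPoint X.left ∈ W) {a' b' : X.left.functionField} (ha' : a' ≠ 0)
    (ha : ∀ y ∈ W, IsRegularAt y a') (hb : ∀ y ∈ W, IsRegularAt y b')
    {g : ComplexPoints X → ℂ} (hg : ContinuousOn g {P | P.pt ∈ W})
    (hgab : ∀ (P : ComplexPoints X) (hP : P.pt ∈ W),
      g P * P.eval W hP (sectionOf hW a' ha) = P.eval W hP (sectionOf hW b' hb))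
    {x : X.left} (hx : x ∈ W) : IsRegularAt x (b' / a') := by
  -- an affine open `V` with `x ∈ V ≤ W`
  obtain ⟨_, ⟨V, hVaff, rfl⟩, hxV, hVW⟩ := X.left.isBasis_affineOpens.exists_subset_of_mem_open hx W.isOpen
  haveI : Nonempty V := ⟨⟨x, hxV⟩⟩
  have hVle : V ≤ W := hVW
  -- the two sections restricted to `V`
  set a : Γ(X.left, V) := X.left.presheaf.map (homOfLE hVle).op (sectionOf hW a' ha) with ha_def
  set b : Γ(X.left, V) := X.left.presheaf.map (homOfLE hVle).op (sectionOf hW b' hb) with hb_def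
  have hVgen : genericPoint X.left ∈ V := genericPoint_mem_of_mem hxV
  have haK : algebraMap Γ(X.left, V) X.left.functionField a = a' := by
    change ofSection hVgen a = a'
    rw [ha_def, ofSection_map, ofSection_sectionOf]
  have hbK : algebraMap Γ(X.left, V) X.left.functionField b = b' := by
    change ofSection hVgen b = b'
    rw [hb_def, ofSection_map, ofSection_sectionOf]
  have ha0 : a ≠ 0 := by
    intro h0
    apply ha'
    rw [← haK, h0, map_zero]
  have hgV : ContinuousOn g {P | P.pt ∈ V} := hg.mono fun P hP ↦ hVle hP
  have hgabV : ∀ (P : ComplexPoints X) (hP : P.pt ∈ V), g P * P.eval V hP a = P.eval V hP b := by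
    intro P hP
    rw [ha_def, hb_def, AlgPoints.eval_res P hVle hP, AlgPoints.eval_res P hVle hP]
    exact hgab P (hVle hP)
  have key := ContinuousRational.isRegularAt_of_continuous (X := X) hVaff hreg ha0 hgV hgabV ⟨x, hxV⟩
  rwa [haK, hbK] at key

/-- **The matched quotient is a UNIT.**  Same setting with `b' ≠ 0` and `g` continuous and NOWHERE ZERO on `W(ℂ)`: then
`b'/a' ∈ 𝒪_{X,x}^×` for every `x ∈ W` (apply the Hartogs step to `g` and to `g⁻¹`, then ★ `IsRegularAt.isUnitAt_of_mul`).
[cite: Matsumura1987, Thm. 11.5 (p. 82)] [cite: SerreGAGA1956, n° 19 (p. 29)] -/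
theorem isUnitAt_div_of_continuousOn_eval
    (hreg : ∀ x : X.left, IsRegularLocalRing (X.left.presheaf.stalk x))
    {W : X.left.Opens} (hW : genericPoint X.left ∈ W) {a' b' : X.left.functionField} (ha' : a' ≠ 0) (hb' : b' ≠ 0)
    (ha : ∀ y ∈ W, IsRegularAt y a') (hb : ∀ y ∈ W, IsRegularAt y b')
    {g : ComplexPoints X → ℂ} (hg : ContinuousOn g {P | P.pt ∈ W}) (hg0 : ∀ P : ComplexPoints X, P.pt ∈ W → g P ≠ 0)
    (hgab : ∀ (P : ComplexPoints X) (hP : P.pt ∈ W),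
      g P * P.eval W hP (sectionOf hW a' ha) = P.eval W hP (sectionOf hW b' hb))
    {x : X.left} (hx : x ∈ W) : IsUnitAt x (b' / a') := by
  have h1 : IsRegularAt x (b' / a') := isRegularAt_div_of_continuousOn_eval hreg hW ha' ha hb hg hgab hx
  have hg' : ContinuousOn (fun P ↦ (g P)⁻¹) {P | P.pt ∈ W} := hg.inv₀ fun P hP ↦ hg0 P hP
  have hgba : ∀ (P : ComplexPoints X) (hP : P.pt ∈ W),
      (g P)⁻¹ * P.eval W hP (sectionOf hW b' hb) = P.eval W hP (sectionOf hW a' ha) := by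
    intro P hP
    rw [← hgab P hP, ← mul_assoc, inv_mul_cancel₀ (hg0 P hP), one_mul]
  have h2 : IsRegularAt x (a' / b') := isRegularAt_div_of_continuousOn_eval hreg hW hb' hb ha hg' hgba hx
  exact h1.isUnitAt_of_mul h2 (by rw [div_mul_div_cancel₀ ha', div_self hb']; exact isUnitAt_one)

end Local

/-! ### §2. Matched sections under a continuous cocycle isomorphism ⇒ same divisor ⇒ linear equivalence -/

section Global

variable {X : SchemeOver ℂ} [LocallyOfFiniteType X.hom] [IsIntegral X.left] {n : ℕ}
  {E : Type} [NormedAddCommGroup E] [NormedSpace ℂ E] [FiniteDimensional ℂ E]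
  {M : Type} [TopologicalSpace M] [ChartedSpace E M] [IsManifold 𝓘(ℂ, E) ω M] [IsManifold 𝓘(ℝ, E) ∞ M]
  {φ : M → ComplexPoints X}

/-- **`G + div s` and `G' + div τ` are the SAME divisor** when a continuous cocycle isomorphism `Φ : 𝒪_X(G)^an ≅ 𝒪_X(G')^an`
carries `s^an` to `τ^an` (`λ_{a i} · (g_i s)^an = (g'_a τ)^an` on `φ⁻¹((U_i ∩ U'_a)(ℂ))`): on `U_i ∩ U'_a` the quotient
`(g_i s)/(g'_a τ)` takes the continuous nowhere-zero values `λ_{a i}⁻¹`, so it is a unit at every point (§1).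
[cite: SerreGAGA1956, n° 19–20 (pp. 29–32)] [cite: GortzWedhorn2020, Def. 11.20 (p. 373)] -/
theorem _root_.Literature.AlgebraicGeometry.Motives.CartierDivisor.sameDivisor_add_principal_of_cocycleIso
    (hreg : ∀ x : X.left, IsRegularLocalRing (X.left.presheaf.stalk x))
    (hφ : IsAnalytification E X n φ) (G G' : CartierDivisor X.left)
    {s τ : X.left.functionField} (hs : G.IsSection s) (hτ : G'.IsSection τ) (hs0 : s ≠ 0) (hτ0 : τ ≠ 0)
    (Φ : SmoothComplexVectorBundle.CocycleIso (cartierDivisorCocycle hφ G) (cartierDivisorCocycle hφ G'))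
    (hΦ : Φ.IsContinuous)
    (hmatch : ∀ (a : G'.ι) (i : G.ι) (m : M), (φ m).pt ∈ G.U i → (φ m).pt ∈ G'.U a →
      Φ.map a i m 0 0 * G.sectionCoord φ hs i m = G'.sectionCoord φ hτ a m) :
    (G + CartierDivisor.principal s hs0).SameDivisor (G' + CartierDivisor.principal τ hτ0) := by
  classical
  intro p q x hp hq
  -- unfold the sum presentations: `p = (i, ⋆)`, `q = (a, ⋆)`, local equations `g_i s`, `g'_a τ` on `U_i`, `U'_a`
  obtain ⟨i, u⟩ := p
  obtain ⟨a, u'⟩ := q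
  change x ∈ G.U i ⊓ ⊤ at hp
  change x ∈ G'.U a ⊓ ⊤ at hq
  change IsUnitAt x (G.f i * s / (G'.f a * τ))
  have hxi : x ∈ G.U i := hp.1
  have hxa : x ∈ G'.U a := hq.1
  -- work on `W = U_i ∩ U'_a`
  have hxW : x ∈ G.U i ⊓ G'.U a := ⟨hxi, hxa⟩
  have hW : genericPoint X.left ∈ G.U i ⊓ G'.U a := genericPoint_mem_of_mem hxW
  have hWi : G.U i ⊓ G'.U a ≤ G.U i := inf_le_left
  have hWa : G.U i ⊓ G'.U a ≤ G'.U a := inf_le_right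
  have hb : ∀ y ∈ G.U i ⊓ G'.U a, IsRegularAt y (G.f i * s) := fun y hy ↦ hs i y hy.1
  have ha : ∀ y ∈ G.U i ⊓ G'.U a, IsRegularAt y (G'.f a * τ) := fun y hy ↦ hτ a y hy.2
  -- the continuous nowhere-zero function `P ↦ λ_{a i}(φ⁻¹ P)⁻¹`
  set ψ : ComplexPoints X ≃ₜ M := hφ.homeomorph.symm with hψ_def
  have hφψ : ∀ P, φ (ψ P) = P := fun P ↦ by
    rw [hψ_def]
    exact hφ.homeomorph.apply_symm_apply P
  set g : ComplexPoints X → ℂ := fun P ↦ (Φ.map a i (ψ P) 0 0)⁻¹ with hg_def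
  -- `λ_{a i}` is a unit on the overlap, so its `(0,0)` entry is nonzero
  have hunit : ∀ P : ComplexPoints X, P.pt ∈ G.U i ⊓ G'.U a → Φ.map a i (ψ P) 0 0 ≠ 0 := by
    intro P hP h0
    have hmem : ψ P ∈ (cartierDivisorCocycle hφ G).baseSet i ∩ (cartierDivisorCocycle hφ G').baseSet a := by
      simp only [cartierDivisorCocycle_baseSet, Set.mem_inter_iff, Set.mem_preimage, Set.mem_setOf_eq, hφψ]
      exact ⟨hP.1, hP.2⟩
    have hU := Φ.isUnit_map a i (ψ P) hmem
    rw [Matrix.isUnit_iff_isUnit_det, Matrix.det_fin_one, h0] at hU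
    exact not_isUnit_zero hU
  have hg0 : ∀ P : ComplexPoints X, P.pt ∈ G.U i ⊓ G'.U a → g P ≠ 0 := fun P hP ↦ inv_ne_zero (hunit P hP)
  -- continuity of `g` on `W(ℂ)`: `λ_{a i}` is continuous on the overlap, `ψ` is a homeomorphism
  have hg : ContinuousOn g {P | P.pt ∈ G.U i ⊓ G'.U a} := by
    have hmaps : Set.MapsTo ψ {P : ComplexPoints X | P.pt ∈ G.U i ⊓ G'.U a}
        ((cartierDivisorCocycle hφ G).baseSet i ∩ (cartierDivisorCocycle hφ G').baseSet a) := by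
      intro P hP
      simp only [cartierDivisorCocycle_baseSet, Set.mem_inter_iff, Set.mem_preimage, Set.mem_setOf_eq, hφψ]
      exact ⟨hP.1, hP.2⟩
    have h1 : ContinuousOn (fun P ↦ Φ.map a i (ψ P)) {P | P.pt ∈ G.U i ⊓ G'.U a} :=
      (hΦ a i).comp ψ.continuous.continuousOn hmaps
    have h2 : ContinuousOn (fun P ↦ Φ.map a i (ψ P) 0 0) {P | P.pt ∈ G.U i ⊓ G'.U a} :=
      (continuous_id.matrix_elem 0 0).comp_continuousOn h1
    exact h2.inv₀ fun P hP ↦ hunit P hP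
  -- the two sections over `W`, as restrictions of the sections over `U_i`, `U'_a` (sections with the same germ agree)
  have hres_b : ∀ {P : ComplexPoints X} (hPi : P.pt ∈ G.U i),
      X.left.presheaf.map (homOfLE hWi).op
        (sectionOf (genericPoint_mem_of_mem hPi) (G.f i * s) fun y hy ↦ hs i y hy) = sectionOf hW (G.f i * s) hb := by
    intro P hPi
    apply germ_injective_of_isIntegral X.left (genericPoint X.left) hW
    change ofSection hW _ = ofSection hW _
    rw [ofSection_map, ofSection_sectionOf, ofSection_sectionOf]
  have hres_a : ∀ {P : ComplexPoints X} (hPa : P.pt ∈ G'.U a),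
      X.left.presheaf.map (homOfLE hWa).op
        (sectionOf (genericPoint_mem_of_mem hPa) (G'.f a * τ) fun y hy ↦ hτ a y hy) = sectionOf hW (G'.f a * τ) ha := by
    intro P hPa
    apply germ_injective_of_isIntegral X.left (genericPoint X.left) hW
    change ofSection hW _ = ofSection hW _
    rw [ofSection_map, ofSection_sectionOf, ofSection_sectionOf]
  -- the matching identity read at `P = φ m` through the sections on `W`
  have hgab : ∀ (P : ComplexPoints X) (hP : P.pt ∈ G.U i ⊓ G'.U a),
      g P * P.eval (G.U i ⊓ G'.U a) hP (sectionOf hW (G'.f a * τ) ha) =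
        P.eval (G.U i ⊓ G'.U a) hP (sectionOf hW (G.f i * s) hb) := by
    intro P hP
    obtain ⟨m, rfl⟩ : ∃ m, φ m = P := ⟨ψ P, hφψ P⟩
    have hψm : ψ (φ m) = m := by
      rw [hψ_def]
      exact hφ.homeomorph.symm_apply_apply m
    have hne : Φ.map a i m 0 0 ≠ 0 := by
      have h := hunit (φ m) hP
      rwa [hψm] at h
    have hm := hmatch a i m hP.1 hP.2
    rw [sectionCoord_apply_of_mem hs hP.1, sectionCoord_apply_of_mem hτ hP.2, evalOrZero_of_mem _ hP.1,
      evalOrZero_of_mem _ hP.2] at hm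
    rw [← hres_b hP.1, ← hres_a hP.2, AlgPoints.eval_res (φ m) hWi hP, AlgPoints.eval_res (φ m) hWa hP, ← hm,
      hg_def]
    simp only [hψm]
    rw [← mul_assoc, inv_mul_cancel₀ hne, one_mul]
  exact isUnitAt_div_of_continuousOn_eval hreg hW (mul_ne_zero (G'.f_ne_zero a) hτ0)
    (mul_ne_zero (G.f_ne_zero i) hs0) ha hb hg hg0 hgab hxW

/-- **B1-fin (the carrier-free half of GAGA injectivity on `Pic`).**  `X` integral, locally of finite type over `ℂ`, with
integrally closed local rings; `φ : M → X(ℂ)` an analytification; `G`, `G'` Cartier divisors with nonzero sections `s`, `τ`;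
`Φ : 𝒪_X(G)^an ≅ 𝒪_X(G')^an` a CONTINUOUS cocycle isomorphism carrying `s^an` to `τ^an`.  Then `G ~ G'`
(`G ~ G + div s = G' + div τ ~ G'`).  With H⁰-GAGA for line bundles (every holomorphic section of `𝒪_X(G)^an` is an `s^an`)
this is «`𝒪_X(D)^an ≅ 𝒪_X(E)^an ⇒ D ~ E`» ([SerreGAGA1956] n° 19–20). [cite: SerreGAGA1956, n° 19–20 (pp. 29–32)]
[cite: GortzWedhorn2020, Section (11.9) (p. 374)] [cite: Matsumura1987, Thm. 11.5 (p. 82)] -/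
theorem _root_.Literature.AlgebraicGeometry.Motives.CartierDivisor.linEquiv_of_cocycleIso_sectionCoord
    (hreg : ∀ x : X.left, IsRegularLocalRing (X.left.presheaf.stalk x))
    (hφ : IsAnalytification E X n φ) (G G' : CartierDivisor X.left)
    {s τ : X.left.functionField} (hs : G.IsSection s) (hτ : G'.IsSection τ) (hs0 : s ≠ 0) (hτ0 : τ ≠ 0)
    (Φ : SmoothComplexVectorBundle.CocycleIso (cartierDivisorCocycle hφ G) (cartierDivisorCocycle hφ G'))
    (hΦ : Φ.IsContinuous)
    (hmatch : ∀ (a : G'.ι) (i : G.ι) (m : M), (φ m).pt ∈ G.U i → (φ m).pt ∈ G'.U a →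
      Φ.map a i m 0 0 * G.sectionCoord φ hs i m = G'.sectionCoord φ hτ a m) :
    G.LinEquiv G' := by
  have key := CartierDivisor.sameDivisor_add_principal_of_cocycleIso hreg hφ G G' hs hτ hs0 hτ0 Φ hΦ hmatch
  -- `G ~ G' + div τ` (witness `s`), and `G' ~ G' + div τ` (witness `τ`)
  have h1 : G.LinEquiv (G' + CartierDivisor.principal τ hτ0) := ⟨s, hs0, key⟩
  have h2 : G'.LinEquiv (G' + CartierDivisor.principal τ hτ0) := ⟨τ, hτ0, CartierDivisor.SameDivisor.refl _⟩
  exact h1.trans h2.symm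

/-- The same with a HOLOMORPHIC cocycle isomorphism (`AnalyticallyEquivalent`-grade data), the form road (b4) delivers.
[cite: SerreGAGA1956, n° 19–20 (pp. 29–32)] [cite: FritzscheGrauert2002, Ch. IV §2 (analytically equivalent)] -/
theorem _root_.Literature.AlgebraicGeometry.Motives.CartierDivisor.linEquiv_of_holomorphic_cocycleIso_sectionCoord
    (hreg : ∀ x : X.left, IsRegularLocalRing (X.left.presheaf.stalk x))
    (hφ : IsAnalytification E X n φ) (G G' : CartierDivisor X.left)
    {s τ : X.left.functionField} (hs : G.IsSection s) (hτ : G'.IsSection τ) (hs0 : s ≠ 0) (hτ0 : τ ≠ 0)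
    (Φ : SmoothComplexVectorBundle.CocycleIso (cartierDivisorCocycle hφ G) (cartierDivisorCocycle hφ G'))
    (hΦ : Φ.IsHolomorphic)
    (hmatch : ∀ (a : G'.ι) (i : G.ι) (m : M), (φ m).pt ∈ G.U i → (φ m).pt ∈ G'.U a →
      Φ.map a i m 0 0 * G.sectionCoord φ hs i m = G'.sectionCoord φ hτ a m) :
    G.LinEquiv G' :=
  CartierDivisor.linEquiv_of_cocycleIso_sectionCoord hreg hφ G G' hs hτ hs0 hτ0 Φ hΦ.isContinuous hmatch

end Global

end Literature.AlgebraicGeometry.HodgeTheory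

end
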